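import Mathlib.RingTheory.DualNumber
import Literature.AlgebraicGeometry.Motives.AbelianVarietyMulN
import Literature.NumberTheory.DiophantineGeometry.AVKernelHopf
import HarnessLib

/-!
# `Lie([n]_A) = n`: the tangent space of an abelian variety at the origin via dual numbers

This file **proves** the named fact `Literature.AbelianVariety.cotangentMap_zsmul_id A` of
`Literature.AlgebraicGeometry.Motives.AbelianVarietyMulN`: for an abelian variety `A` over a field
`K` and `n ∈ ℤ`, the endomorphism `[n]_A^*` of the local ring `𝒪_{A,e}` acts on the cotangent space
`𝔪_e/𝔪_e²` as multiplication by `n` (Görtz–Wedhorn, *Algebraic Geometry II*, proof of Prop. 27.187,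
p. 888: "`Lie([n])` is simply the multiplication by `n` (Remark 27.18 (3))"). Consequently
(`AbelianVarietyMulN`, `AbelianVarietyTorsion`):

* `etale_zsmul_id_holds` : `[n]_A` is étale for `n` invertible in `K` (Görtz–Wedhorn II,
  Prop. 27.187) — the named fact `etale_zsmul_id A` is now a theorem;
* `isIsogeny_zsmul_id_of_cast_ne_zero`, `isIsogeny_zsmul_id_holds_of_charZero` : `[n]_A` is an
  isogeny for `n` invertible in `K`;
* `natCard_torsionPoints_of_isAlgClosed_of_kerRank` : the target fact
  `natCard_torsionPoints_of_isAlgClosed A L` (`#A[n](L) = n^{2g}`) follows from the single remaining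
  named fact `kerRank_zsmul_id A` (`deg [n]_A = n^{2g}`, Prop. 27.186, theorem of the cube).

## The proof (Görtz–Wedhorn II, Rem. 27.18 (3)–(4))

Mathlib has no tangent spaces of schemes, so we work with points with values in the local Artinian
`K`-algebras `K`, `K[ε]` (Mathlib `DualNumber`) and `K[ε₁, ε₂]/(ε₁, ε₂)² = K[ε] ×_K K[ε]`
(`Literature.AlgebraicGeometry.Motives.DualNumber₂`), as in Rem. 27.18 (4): `Lie(A) = Ker(A(K[ε]) → A(K))`.

1. *Points at the origin and local homomorphisms.* A morphism `t : Spec R → A` (`R` local) with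
   `t(𝔪_R) = e` has a local homomorphism `ev_t : 𝒪_{A,e} → R` (Mathlib `Scheme.stalkClosedPointTo`),
   and `t ↦ ev_t` is injective with inverse `g ↦ (Spec R → Spec 𝒪_{A,e} → A)` (Mathlib
   `SpecToEquivOfLocalRing`); it is natural in `R` (`ev_{Spec ψ ≫ t} = ψ ∘ ev_t`) and in `[n]`
   (`ev_{t ≫ [n]} = ev_t ∘ [n]^*`), and `ev_t` is a `K`-algebra map for `K`-points. `K`-points
   `Spec K → A` at the origin are unique, so "at the origin" means: in the kernel of `A(R) → A(K)`.
2. *`T_e(m)` is addition* (`snd_evAt_mul`). For `t₁, t₂ ∈ Ker(A(K[ε]) → A(K))` put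
   `u = incl₁^* t₁ · incl₂^* t₂ ∈ A(K[ε₁, ε₂])`. Since `proj₁ ∘ incl₁ = id` and `proj₁ ∘ incl₂` is
   constant, `proj₁^* u = t₁` (this is `m ∘ (id, e) = id`), likewise `proj₂^* u = t₂`, and
   `codiag^* u = t₁ t₂`. Hence `ev_u : 𝒪_{A,e} → K[ε₁, ε₂]` has components `(ev_{t₁}, ev_{t₂})`, and
   the `ε`-part of `ev_{t₁ t₂} = codiag ∘ ev_u` is the sum of the `ε`-parts of `ev_{t₁}`, `ev_{t₂}`.
   So `t ↦ (ε-part of ev_t)` is a homomorphism to the functions `𝒪_{A,e} → K`, and `ev_{tⁿ}` has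
   `ε`-part `n` times that of `ev_t` (`snd_evAt_zpow`), while `tⁿ = t ≫ [n]_A`.
3. *Tangent vectors.* A linear form `ℓ` on `𝔪_e/𝔪_e²` (extended by `0` on `K`) gives the local
   `K`-algebra map `a ↦ a(e) + ℓ(a) ε : 𝒪_{A,e} → K[ε]` (`tangentHom`), hence a point
   `t_ℓ ∈ Ker(A(K[ε]) → A(K))` with `ev_{t_ℓ} = (a ↦ a(e) + ℓ(a) ε)`. By 1–2,
   `ℓ([n]^* a) = n ℓ(a)` for `a ∈ 𝔪_e`, i.e. `ℓ([n]^* a - n a) = 0`; as such `ℓ` separate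
   `𝔪_e/𝔪_e²`, `[n]^* a - n a ∈ 𝔪_e²`.

## Main statements

* `Literature.AlgebraicGeometry.Motives.AbelianVariety.evAt`, `ptOfStalkHom`, `evAt_ptOfStalkHom`, `ptOfStalkHom_evAt`,
  `evAt_SpecMap_comp`, `evAt_comp_zsmul_id`, `eq_of_base_eq_origin`.
* `Literature.AlgebraicGeometry.Motives.AbelianVariety.snd_evAt_mul` (`T_e(m)` is addition), `snd_evAt_zpow` (`T_e([n]) = n`).
* `Literature.AlgebraicGeometry.Motives.AbelianVariety.tangentHom`, `mem_sq_of_forall_eq_zero` (tangent vectors separate `𝔪_e/𝔪_e²`).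
* `Literature.AlgebraicGeometry.Motives.AbelianVariety.cotangentMap_zsmul_id_holds`, `etale_zsmul_id_holds`,
  `isIsogeny_zsmul_id_of_cast_ne_zero`, `natCard_torsionPoints_of_isAlgClosed_of_kerRank`.

## Design notes

* `IsLocalRing (DualNumber K)` is Mathlib's (`Mathlib.RingTheory.DualNumber`); the instance
  `IsLocalRing (DualNumber₂ K)` (from `isLocalRing_trivSqZeroExt`, any square-zero extension of a
  field) and the `IsLocalHom` instances for the structure maps between `K`, `K[ε]`, `K[ε₁, ε₂]` are
  new (Mathlib has no `IsLocalRing` instance for a general `TrivSqZeroExt`) and override no library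
  instance.
* Mathlib searched and used: `Scheme.stalkClosedPointTo`, `Scheme.Spec_stalkClosedPointTo_fromSpecStalk`,
  `Scheme.germ_stalkClosedPointTo_Spec_fromSpecStalk`, `Scheme.SpecMap_stalkMap_fromSpecStalk`,
  `Scheme.SpecMap_stalkSpecializes_fromSpecStalk`, `Spec_closedPoint`, `TrivSqZeroExt.map`/`fstHom`/
  `isUnit_iff_isUnit_fst`, `MonObj.comp_mul`/`comp_one`, `GrpObj.comp_zpow`,
  `Submodule.exists_dual_map_eq_bot_of_notMem`, the instance `IsLocalRing K[ε]`; Mathlib has no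
  tangent space of a scheme at a point and no Lie algebra of a group scheme.
* `specOverMapOfAlgHom` (Spec of a `K`-algebra map as a morphism of `K`-schemes) is the one of
  `Literature.NumberTheory.DiophantineGeometry.AVKernelHopf`, imported for that purpose.

## References

* U. Görtz, T. Wedhorn, *Algebraic Geometry II* (2023): Def. 27.17, Rem. 27.18 (1)–(4) and (27.4.6)
  (pp. 805–806), Prop. 27.186–27.188 (pp. 887–888). [GortzWedhorn2023]
* D. Mumford, *Abelian Varieties* (1970), §4 (iv) and §6, Application 3 (not held). [MumfordAV1970]
-/

universe u

open CategoryTheory CategoryTheory.Limits AlgebraicGeometry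

noncomputable section

namespace Literature.AlgebraicGeometry.Motives

/-! ### Dual numbers `K[ε]` and `K[ε₁, ε₂]/(ε₁, ε₂)²` -/

section DualNumbers

open TrivSqZeroExt

variable (K : Type u) [Field K]

/-- The square-zero extensions `K ⊕ M` of a field are local rings (the non-units `0 ⊕ M` form an
ideal); Mathlib has this only for `M = K` (`IsLocalRing K[ε]`, `Mathlib.RingTheory.DualNumber`).
[folklore] -/
theorem isLocalRing_trivSqZeroExt (M : Type u) [AddCommGroup M] [Module K M] [Module Kᵐᵒᵖ M]
    [IsCentralScalar K M] : IsLocalRing (TrivSqZeroExt K M) :=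
  IsLocalRing.of_isUnit_or_isUnit_one_sub_self fun x => by
    rcases eq_or_ne x.fst 0 with h | h
    · right
      rw [isUnit_iff_isUnit_fst, fst_sub, fst_one, h, sub_zero]
      exact isUnit_one
    · left
      exact isUnit_iff_isUnit_fst.mpr (isUnit_iff_ne_zero.mpr h)

/-- `K[ε₁, ε₂]/(ε₁, ε₂)² = K[ε] ×_K K[ε]`, the square-zero extension of `K` by `K²`
(Görtz–Wedhorn II, Rem. 27.18 (3)–(4): the coefficient ring computing `T_e(m)`). [folklore] -/
abbrev DualNumber₂ : Type u := TrivSqZeroExt K (K × K)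

/-- `K[ε₁, ε₂]/(ε₁, ε₂)²` is a local ring (Mathlib's instance `IsLocalRing K[ε]`,
`Mathlib.RingTheory.DualNumber`, covers only `M = K`; this one overrides nothing). [folklore] -/
instance isLocalRing_dualNumber₂ : IsLocalRing (DualNumber₂ K) := isLocalRing_trivSqZeroExt K (K × K)

/-- The augmentation `K[ε] → K`, `ε ↦ 0` (Mathlib `TrivSqZeroExt.fstHom`). [folklore] -/
abbrev dualNumberAug : DualNumber K →ₐ[K] K := fstHom K K K

namespace DualNumber₂

/-- The augmentation `K[ε₁, ε₂] → K`. [folklore] -/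
abbrev aug : DualNumber₂ K →ₐ[K] K := fstHom K K (K × K)
/-- The first projection `K[ε₁, ε₂] → K[ε]`, `ε₁ ↦ ε`, `ε₂ ↦ 0`. [folklore] -/
abbrev proj₁ : DualNumber₂ K →ₐ[K] DualNumber K := TrivSqZeroExt.map (LinearMap.fst K K K)
/-- The second projection `K[ε₁, ε₂] → K[ε]`, `ε₁ ↦ 0`, `ε₂ ↦ ε`. [folklore] -/
abbrev proj₂ : DualNumber₂ K →ₐ[K] DualNumber K := TrivSqZeroExt.map (LinearMap.snd K K K)
/-- The first inclusion `K[ε] → K[ε₁, ε₂]`, `ε ↦ ε₁`. [folklore] -/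
abbrev incl₁ : DualNumber K →ₐ[K] DualNumber₂ K := TrivSqZeroExt.map (LinearMap.inl K K K)
/-- The second inclusion `K[ε] → K[ε₁, ε₂]`, `ε ↦ ε₂`. [folklore] -/
abbrev incl₂ : DualNumber K →ₐ[K] DualNumber₂ K := TrivSqZeroExt.map (LinearMap.inr K K K)
/-- The codiagonal `K[ε₁, ε₂] → K[ε]`, `ε₁, ε₂ ↦ ε` (it induces the addition of tangent vectors,
Görtz–Wedhorn II, Rem. 27.18 (3)). [folklore] -/
abbrev codiag : DualNumber₂ K →ₐ[K] DualNumber K :=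
  TrivSqZeroExt.map (LinearMap.fst K K K + LinearMap.snd K K K)

/-- `proj₁ ∘ incl₁ = id`. [folklore] -/
theorem proj₁_comp_incl₁ : (proj₁ K).comp (incl₁ K) = AlgHom.id K _ := by
  rw [← map_comp_map, LinearMap.fst_comp_inl, TrivSqZeroExt.map_id]

/-- `proj₂ ∘ incl₂ = id`. [folklore] -/
theorem proj₂_comp_incl₂ : (proj₂ K).comp (incl₂ K) = AlgHom.id K _ := by
  rw [← map_comp_map, LinearMap.snd_comp_inr, TrivSqZeroExt.map_id]

/-- `codiag ∘ incl₁ = id`. [folklore] -/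
theorem codiag_comp_incl₁ : (codiag K).comp (incl₁ K) = AlgHom.id K _ := by
  rw [← map_comp_map, LinearMap.add_comp, LinearMap.fst_comp_inl, LinearMap.snd_comp_inl, add_zero,
    TrivSqZeroExt.map_id]

/-- `codiag ∘ incl₂ = id`. [folklore] -/
theorem codiag_comp_incl₂ : (codiag K).comp (incl₂ K) = AlgHom.id K _ := by
  rw [← map_comp_map, LinearMap.add_comp, LinearMap.fst_comp_inr, LinearMap.snd_comp_inr, zero_add,
    TrivSqZeroExt.map_id]

/-- `proj₁ ∘ incl₂` is the constant map `K[ε] → K → K[ε]`. [folklore] -/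
theorem proj₁_comp_incl₂ :
    (proj₁ K).comp (incl₂ K) = (Algebra.ofId K (DualNumber K)).comp (dualNumberAug K) := by
  refine algHom_ext fun m => ?_
  rw [AlgHom.comp_apply, AlgHom.comp_apply, map_inr, map_inr, LinearMap.inr_apply,
    LinearMap.fst_apply, inr_zero, fstHom_apply, fst_inr, map_zero]

/-- `proj₂ ∘ incl₁` is the constant map `K[ε] → K → K[ε]`. [folklore] -/
theorem proj₂_comp_incl₁ :
    (proj₂ K).comp (incl₁ K) = (Algebra.ofId K (DualNumber K)).comp (dualNumberAug K) := by
  refine algHom_ext fun m => ?_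
  rw [AlgHom.comp_apply, AlgHom.comp_apply, map_inr, map_inr, LinearMap.inl_apply,
    LinearMap.snd_apply, inr_zero, fstHom_apply, fst_inr, map_zero]

/-- `aug ∘ incl₁ = aug`. [folklore] -/
theorem aug_comp_incl₁ : (aug K).comp (incl₁ K) = dualNumberAug K := fstHom_comp_map _

/-- `aug ∘ incl₂ = aug`. [folklore] -/
theorem aug_comp_incl₂ : (aug K).comp (incl₂ K) = dualNumberAug K := fstHom_comp_map _

end DualNumber₂

/-- A `K`-algebra map between square-zero extensions commuting with the augmentations is a local
homomorphism. [folklore] -/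
theorem isLocalHom_of_fst_eq {M N : Type u} [AddCommGroup M] [Module K M] [Module Kᵐᵒᵖ M]
    [IsCentralScalar K M] [AddCommGroup N] [Module K N] [Module Kᵐᵒᵖ N] [IsCentralScalar K N]
    (f : TrivSqZeroExt K M →ₐ[K] TrivSqZeroExt K N) (hf : ∀ x, (f x).fst = x.fst) :
    IsLocalHom f.toRingHom :=
  ⟨fun x hx => by
    rw [AlgHom.toRingHom_eq_coe, RingHom.coe_coe, isUnit_iff_isUnit_fst, hf] at hx
    exact isUnit_iff_isUnit_fst.mpr hx⟩

/-- The augmentation of `K[ε]` is local. [folklore] -/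
instance isLocalHom_dualNumberAug : IsLocalHom (dualNumberAug K).toRingHom :=
  ⟨fun _ hx => isUnit_iff_isUnit_fst.mpr hx⟩

/-- The augmentation of `K[ε₁, ε₂]` is local. [folklore] -/
instance isLocalHom_aug : IsLocalHom (DualNumber₂.aug K).toRingHom :=
  ⟨fun _ hx => isUnit_iff_isUnit_fst.mpr hx⟩

/-- `proj₁` is local. [folklore] -/
instance isLocalHom_proj₁ : IsLocalHom (DualNumber₂.proj₁ K).toRingHom :=
  isLocalHom_of_fst_eq K _ (fst_map _)

/-- `proj₂` is local. [folklore] -/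
instance isLocalHom_proj₂ : IsLocalHom (DualNumber₂.proj₂ K).toRingHom :=
  isLocalHom_of_fst_eq K _ (fst_map _)

/-- `incl₁` is local. [folklore] -/
instance isLocalHom_incl₁ : IsLocalHom (DualNumber₂.incl₁ K).toRingHom :=
  isLocalHom_of_fst_eq K _ (fst_map _)

/-- `incl₂` is local. [folklore] -/
instance isLocalHom_incl₂ : IsLocalHom (DualNumber₂.incl₂ K).toRingHom :=
  isLocalHom_of_fst_eq K _ (fst_map _)

/-- `codiag` is local. [folklore] -/
instance isLocalHom_codiag : IsLocalHom (DualNumber₂.codiag K).toRingHom :=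
  isLocalHom_of_fst_eq K _ (fst_map _)

end DualNumbers

namespace AbelianVariety

open scoped MonObj

variable {K : Type u} [Field K] {A B : AbelianVariety K}

/-! ### Points of `A` at the origin with values in local rings, and their local homomorphisms -/

section PointsAtOrigin

variable {R : CommRingCat.{u}} [IsLocalRing R]

/-- The morphism `Spec R → A` defined by a (local) homomorphism `g : 𝒪_{A,e} → R`:
`Spec R → Spec 𝒪_{A,e} → A` (the inverse direction of Mathlib `Scheme.SpecToEquivOfLocalRing`).
[folklore] -/
def ptOfStalkHom (g : stalkOrigin A ⟶ R) : Spec R ⟶ A.X.left :=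
  Spec.map g ≫ A.X.left.fromSpecStalk (origin A)

/-- `ptOfStalkHom g` maps the closed point to the origin when `g` is local. [folklore] -/
theorem ptOfStalkHom_closedPoint (g : stalkOrigin A ⟶ R) [IsLocalHom g.hom] :
    (ptOfStalkHom g).base (IsLocalRing.closedPoint R) = origin A := by
  rw [ptOfStalkHom, Scheme.Hom.comp_apply, Spec_closedPoint, Scheme.fromSpecStalk_closedPoint]

/-- The local homomorphism `𝒪_{A,e} → R` of a morphism `t : Spec R → A` mapping the closed point
to the origin (Mathlib `Scheme.stalkClosedPointTo`, transported along `t(𝔪_R) = e`). [folklore] -/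
def evAt (t : Spec R ⟶ A.X.left) (ht : t.base (IsLocalRing.closedPoint R) = origin A) :
    stalkOrigin A ⟶ R :=
  (A.X.left.presheaf.stalkCongr (.of_eq ht)).inv ≫ Scheme.stalkClosedPointTo t

/-- `evAt t` is a local homomorphism. [folklore] -/
instance isLocalHom_evAt (t : Spec R ⟶ A.X.left)
    (ht : t.base (IsLocalRing.closedPoint R) = origin A) : IsLocalHom (evAt t ht).hom := by
  unfold evAt
  rw [CommRingCat.hom_comp]
  haveI := isLocalHom_of_isIso (A.X.left.presheaf.stalkCongr (.of_eq ht)).inv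
  infer_instance

/-- `evAt` does not depend on the proof and is compatible with equalities of points. [folklore] -/
theorem evAt_congr {t t' : Spec R ⟶ A.X.left} (h : t = t')
    (ht : t.base (IsLocalRing.closedPoint R) = origin A)
    (ht' : t'.base (IsLocalRing.closedPoint R) = origin A) : evAt t ht = evAt t' ht' := by
  subst h; rfl

/-- `evAt (ptOfStalkHom g) = g` (one half of Mathlib `Scheme.SpecToEquivOfLocalRing`, via
`Scheme.germ_stalkClosedPointTo_Spec_fromSpecStalk`). [folklore] -/
theorem evAt_ptOfStalkHom (g : stalkOrigin A ⟶ R) [IsLocalHom g.hom]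
    (h : (ptOfStalkHom g).base (IsLocalRing.closedPoint R) = origin A) :
    evAt (ptOfStalkHom g) h = g := by
  unfold ptOfStalkHom
  apply TopCat.Presheaf.stalk_hom_ext
  intro U hU
  rw [evAt, TopCat.Presheaf.stalkCongr_inv, TopCat.Presheaf.germ_stalkSpecializes_assoc,
    Scheme.germ_stalkClosedPointTo_Spec_fromSpecStalk]

/-- `ptOfStalkHom (evAt t) = t` (the other half of Mathlib `Scheme.SpecToEquivOfLocalRing`,
`Scheme.Spec_stalkClosedPointTo_fromSpecStalk`). [folklore] -/
theorem ptOfStalkHom_evAt (t : Spec R ⟶ A.X.left)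
    (ht : t.base (IsLocalRing.closedPoint R) = origin A) : ptOfStalkHom (evAt t ht) = t := by
  unfold ptOfStalkHom evAt
  rw [Spec.map_comp, Category.assoc, TopCat.Presheaf.stalkCongr_inv,
    Scheme.SpecMap_stalkSpecializes_fromSpecStalk, Scheme.Spec_stalkClosedPointTo_fromSpecStalk]

omit [IsLocalRing R] in
/-- Functoriality in `R`: `Spec S → Spec R → A` is the point of `g ≫ ψ`. [folklore] -/
theorem SpecMap_comp_ptOfStalkHom {S : CommRingCat.{u}} (ψ : R ⟶ S) (g : stalkOrigin A ⟶ R) :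
    Spec.map ψ ≫ ptOfStalkHom g = ptOfStalkHom (g ≫ ψ) := by
  rw [ptOfStalkHom, ptOfStalkHom, Spec.map_comp, Category.assoc]

/-- Functoriality in `R` for `evAt`: the local homomorphism of `Spec S → Spec R → A` is
`ψ ∘ evAt t`. [folklore] -/
theorem evAt_SpecMap_comp {S : CommRingCat.{u}} [IsLocalRing S] (ψ : R ⟶ S) [IsLocalHom ψ.hom]
    (t : Spec R ⟶ A.X.left) (ht : t.base (IsLocalRing.closedPoint R) = origin A)
    (ht' : (Spec.map ψ ≫ t).base (IsLocalRing.closedPoint S) = origin A) :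
    evAt (Spec.map ψ ≫ t) ht' = evAt t ht ≫ ψ := by
  have key : Spec.map ψ ≫ t = ptOfStalkHom (evAt t ht ≫ ψ) := by
    conv_lhs => rw [← ptOfStalkHom_evAt t ht]
    rw [SpecMap_comp_ptOfStalkHom]
  haveI : IsLocalHom (evAt t ht ≫ ψ).hom := by rw [CommRingCat.hom_comp]; infer_instance
  rw [evAt_congr key ht' (key ▸ ht'), evAt_ptOfStalkHom]

/-- `Spec 𝒪_{A,e} → A → Spec K` is `Spec` of the `K`-algebra structure map of `𝒪_{A,e}`. [folklore] -/
theorem fromSpecStalk_origin_comp_hom :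
    A.X.left.fromSpecStalk (origin A) ≫ A.X.hom =
      Spec.map (CommRingCat.ofHom (stalkOriginAlgebraMap A)) := by
  rw [← Scheme.SpecMap_stalkMap_fromSpecStalk, Spec.fromSpecStalk_eq, ← Spec.map_comp,
    Category.assoc, Scheme.Hom.germ_stalkMap]
  rfl

omit [IsLocalRing R] in
/-- Functoriality in `[n]`: `Spec R → A —[n]→ A` is the point of `[n]^* ≫ g`
(Görtz–Wedhorn II, Rem. 27.18 (1): `T_e(f)` by functoriality). [folklore] -/
theorem ptOfStalkHom_comp_zsmul_id (g : stalkOrigin A ⟶ R) (n : ℤ) :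
    ptOfStalkHom g ≫ Hom.toSchemeHom (n • 𝟙 A) = ptOfStalkHom (stalkMapZsmulId A n ≫ g) := by
  rw [ptOfStalkHom, ptOfStalkHom, stalkMapZsmulId, Category.assoc,
    ← Scheme.SpecMap_stalkMap_fromSpecStalk, TopCat.Presheaf.stalkCongr_inv,
    ← Scheme.SpecMap_stalkSpecializes_fromSpecStalk
      (specializes_of_eq (toSchemeHom_origin (n • 𝟙 A))),
    Spec.map_comp, Spec.map_comp, Category.assoc, Category.assoc]

/-- Functoriality in `[n]` for `evAt`: `evAt (t ≫ [n]) = [n]^* ≫ evAt t`. [folklore] -/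
theorem evAt_comp_zsmul_id (t : Spec R ⟶ A.X.left)
    (ht : t.base (IsLocalRing.closedPoint R) = origin A) (n : ℤ)
    (ht' : (t ≫ Hom.toSchemeHom (n • 𝟙 A)).base (IsLocalRing.closedPoint R) = origin A) :
    evAt (t ≫ Hom.toSchemeHom (n • 𝟙 A)) ht' = stalkMapZsmulId A n ≫ evAt t ht := by
  have key : t ≫ Hom.toSchemeHom (n • 𝟙 A) = ptOfStalkHom (stalkMapZsmulId A n ≫ evAt t ht) := by
    conv_lhs => rw [← ptOfStalkHom_evAt t ht]
    rw [ptOfStalkHom_comp_zsmul_id]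
  haveI : IsLocalHom (stalkMapZsmulId A n ≫ evAt t ht).hom := by
    rw [CommRingCat.hom_comp]; infer_instance
  rw [evAt_congr key ht' (key ▸ ht'), evAt_ptOfStalkHom]

end PointsAtOrigin

/-! ### `K`-points at the origin: compatibility with the `K`-structure and uniqueness -/

section OverPoints

open AlgPoints

variable {R : Type u} [CommRing R] [Algebra K R] [IsLocalRing R]

/-- The local homomorphism of a `K`-point `Spec R → A` at the origin is a `K`-algebra map. [folklore] -/
theorem evAt_comp_algebraMap (t : specOver K R ⟶ A.X)
    (ht : t.left.base (IsLocalRing.closedPoint R) = origin A) :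
    (evAt t.left ht).hom.comp (stalkOriginAlgebraMap A) = algebraMap K R := by
  have h1 : Spec.map (CommRingCat.ofHom ((evAt t.left ht).hom.comp (stalkOriginAlgebraMap A))) =
      Spec.map (CommRingCat.ofHom (algebraMap K R)) := by
    rw [CommRingCat.ofHom_comp, CommRingCat.ofHom_hom, Spec.map_comp,
      ← fromSpecStalk_origin_comp_hom, ← Category.assoc]
    change ptOfStalkHom (evAt t.left ht) ≫ A.X.hom = _
    rw [ptOfStalkHom_evAt]
    exact Over.w t
  exact congrArg CommRingCat.Hom.hom (Spec.map_injective h1)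

/-- The `K`-point `Spec R → A` at the origin defined by a local `K`-algebra map `v : 𝒪_{A,e} → R`.
[folklore] -/
def ptOver (v : stalkOrigin A ⟶ CommRingCat.of R)
    (hv : v.hom.comp (stalkOriginAlgebraMap A) = algebraMap K R) : specOver K R ⟶ A.X :=
  Over.homMk (ptOfStalkHom v) (by
    change ptOfStalkHom v ≫ A.X.hom = Spec.map (CommRingCat.ofHom (algebraMap K R))
    rw [ptOfStalkHom, Category.assoc, fromSpecStalk_origin_comp_hom, ← Spec.map_comp, ← hv]
    rfl)

omit [IsLocalRing R] in
/-- Underlying morphism of `ptOver`. [folklore] -/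
@[simp]
theorem ptOver_left (v : stalkOrigin A ⟶ CommRingCat.of R)
    (hv : v.hom.comp (stalkOriginAlgebraMap A) = algebraMap K R) :
    (ptOver v hv).left = ptOfStalkHom v := rfl

/-- There is at most one local `K`-algebra homomorphism `𝒪_{A,e} → K` (namely evaluation at the
rational point `e`). [folklore] -/
theorem localHom_ext {ρ ρ' : stalkOrigin A →+* K} [IsLocalHom ρ] [IsLocalHom ρ']
    (h : ρ.comp (stalkOriginAlgebraMap A) = RingHom.id K)
    (h' : ρ'.comp (stalkOriginAlgebraMap A) = RingHom.id K) : ρ = ρ' := by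
  have key : ∀ (ρ : stalkOrigin A →+* K) [IsLocalHom ρ],
      ρ.comp (stalkOriginAlgebraMap A) = RingHom.id K → ∀ (a : stalkOrigin A) (c : K),
        a - stalkOriginAlgebraMap A c ∈ IsLocalRing.maximalIdeal (stalkOrigin A) → ρ a = c := by
    intro ρ _ hρ a c hac
    have h0 : ρ (a - stalkOriginAlgebraMap A c) = 0 := by
      by_contra hne
      exact (IsLocalRing.mem_maximalIdeal _).mp hac
        ((isUnit_map_iff ρ _).mp (isUnit_iff_ne_zero.mpr hne))
    have h1 : ρ (stalkOriginAlgebraMap A c) = c := by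
      rw [← RingHom.comp_apply, hρ, RingHom.id_apply]
    rwa [map_sub, h1, sub_eq_zero] at h0
  ext a
  obtain ⟨c, hc⟩ := exists_sub_algebraMap_mem_maximalIdeal A a
  rw [key ρ h a c hc, key ρ' h' a c hc]

/-- **Uniqueness of `K`-points at the origin:** two `K`-points `Spec K → A` over `K` mapping the point
to the origin are equal (both correspond to the unique local `K`-algebra map `𝒪_{A,e} → K`).
[folklore] -/
theorem eq_of_base_eq_origin (s s' : specOver K K ⟶ A.X)
    (hs : s.left.base (IsLocalRing.closedPoint K) = origin A)
    (hs' : s'.left.base (IsLocalRing.closedPoint K) = origin A) : s = s' := by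
  apply Over.OverMorphism.ext
  rw [← ptOfStalkHom_evAt s.left hs, ← ptOfStalkHom_evAt s'.left hs']
  congr 1
  ext1
  have h1 := evAt_comp_algebraMap s hs
  have h2 := evAt_comp_algebraMap s' hs'
  rw [Algebra.algebraMap_self] at h1 h2
  haveI := isLocalHom_evAt (R := CommRingCat.of K) s.left hs
  haveI := isLocalHom_evAt (R := CommRingCat.of K) s'.left hs'
  exact localHom_ext h1 h2

omit [IsLocalRing R] in
/-- The trivial point `1 : Spec R → A` maps every point to the origin. [folklore] -/
theorem one_left_base (x : ↥(Spec (CommRingCat.of R))) :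
    (1 : specOver K R ⟶ A.X).left.base x = origin A := by
  rw [one_left, Scheme.Hom.comp_apply, eq_specPt K ((specOver K R).hom.base x)]

variable (aug : R →ₐ[K] K) [IsLocalHom aug.toRingHom]

/-- Precomposition with a morphism of `K`-schemes is a homomorphism on points of `A` (Mathlib
`MonObj.comp_mul`, `MonObj.comp_one`). [folklore] -/
def precompHom {T T' : SchemeOver K} (g : T' ⟶ T) : (T ⟶ A.X) →* (T' ⟶ A.X) where
  toFun t := g ≫ t
  map_one' := MonObj.comp_one g
  map_mul' := MonObj.comp_mul g

/-- Unfolding of `precompHom`. [folklore] -/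
@[simp]
theorem precompHom_apply {T T' : SchemeOver K} (g : T' ⟶ T) (t : T ⟶ A.X) :
    precompHom (A := A) g t = g ≫ t := rfl

/-- The `R`-points of `A` at the origin: the kernel of `A(R) → A(K)` along an augmentation
`aug : R → K` (a local `K`-algebra map); for `R = K[ε]` this is `Lie(A) = Ker(A(K[ε]) → A(K))`
(Görtz–Wedhorn II, Rem. 27.18 (4), (27.4.6)). [folklore] -/
def kerAug : Subgroup (specOver K R ⟶ A.X) := (precompHom (A := A) (specOverMapOfAlgHom aug)).ker

omit [IsLocalRing R] [IsLocalHom aug.toRingHom] in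
/-- Membership in `kerAug`. [folklore] -/
theorem mem_kerAug_iff (t : specOver K R ⟶ A.X) :
    t ∈ kerAug (A := A) aug ↔ specOverMapOfAlgHom aug ≫ t = 1 :=
  MonoidHom.mem_ker

omit [IsLocalRing R] in
/-- `Spec aug : Spec K → Spec R` hits the closed point. [folklore] -/
theorem specOverMapOfAlgHom_closedPoint [IsLocalRing R] :
    (specOverMapOfAlgHom aug).left.base (IsLocalRing.closedPoint K) = IsLocalRing.closedPoint R := by
  rw [specOverMapOfAlgHom_left]
  exact Spec_closedPoint (f := CommRingCat.ofHom aug.toRingHom)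

/-- Points in `kerAug` map the closed point to the origin. [folklore] -/
theorem base_eq_origin_of_mem_kerAug {t : specOver K R ⟶ A.X} (ht : t ∈ kerAug (A := A) aug) :
    t.left.base (IsLocalRing.closedPoint R) = origin A := by
  rw [mem_kerAug_iff] at ht
  rw [← specOverMapOfAlgHom_closedPoint aug, ← Scheme.Hom.comp_apply, ← Over.comp_left, ht]
  exact one_left_base _

/-- Conversely, points mapping the closed point to the origin lie in `kerAug` (uniqueness of
`K`-points at the origin). [folklore] -/
theorem mem_kerAug_of_base_eq_origin {t : specOver K R ⟶ A.X}
    (ht : t.left.base (IsLocalRing.closedPoint R) = origin A) : t ∈ kerAug (A := A) aug := by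
  rw [mem_kerAug_iff]
  apply eq_of_base_eq_origin
  · rw [Over.comp_left, Scheme.Hom.comp_apply, specOverMapOfAlgHom_closedPoint, ht]
  · exact one_left_base _

omit [IsLocalRing R] in
/-- `Spec` of a composite of `K`-algebra maps. [folklore] -/
theorem specOverMapOfAlgHom_comp {R' R'' : Type u} [CommRing R'] [Algebra K R'] [CommRing R'']
    [Algebra K R''] (ψ₁ : R →ₐ[K] R') (ψ₂ : R' →ₐ[K] R'') :
    specOverMapOfAlgHom ψ₂ ≫ specOverMapOfAlgHom ψ₁ = specOverMapOfAlgHom (ψ₂.comp ψ₁) := by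
  apply Over.OverMorphism.ext
  rw [Over.comp_left, specOverMapOfAlgHom_left, specOverMapOfAlgHom_left,
    specOverMapOfAlgHom_left]
  exact (Spec.map_comp (CommRingCat.ofHom ψ₁.toRingHom) (CommRingCat.ofHom ψ₂.toRingHom)).symm

omit [IsLocalRing R] in
/-- `Spec` of the identity. [folklore] -/
theorem specOverMapOfAlgHom_id : specOverMapOfAlgHom (AlgHom.id K R) = 𝟙 _ := by
  apply Over.OverMorphism.ext
  rw [specOverMapOfAlgHom_left, Over.id_left]
  exact Spec.map_id _

end OverPoints

/-! ### `T_e(m)` is addition (Görtz–Wedhorn II, Rem. 27.18 (3)) -/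

section LieAddition

open TrivSqZeroExt AlgPoints

/-- For `t ∈ kerAug aug`, the pull-back of `t` along a constant map `R → K → R'` is trivial. [folklore] -/
theorem specOverMapOfAlgHom_ofId_comp_aug_comp {R R' : Type u} [CommRing R] [Algebra K R]
    [CommRing R'] [Algebra K R'] (aug : R →ₐ[K] K) {t : specOver K R ⟶ A.X}
    (ht : t ∈ kerAug (A := A) aug) :
    specOverMapOfAlgHom ((Algebra.ofId K R').comp aug) ≫ t = 1 := by
  rw [← specOverMapOfAlgHom_comp, Category.assoc, (mem_kerAug_iff aug t).mp ht, MonObj.comp_one]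

/-- **`T_e(m)` is addition** (Görtz–Wedhorn II, Rem. 27.18 (3), p. 806): for two `K[ε]`-points
`t₁, t₂` of `A` at the origin, the `ε`-part of the local homomorphism `𝒪_{A,e} → K[ε]` of the
product `t₁ t₂` is the sum of those of `t₁` and `t₂`. Proof (loc. cit.: `m ∘ (id, e) = id`,
`m ∘ (e, id) = id`): the `K[ε₁, ε₂]`-point `u = incl₁^*(t₁) · incl₂^*(t₂)` has projections
`proj₁^* u = t₁`, `proj₂^* u = t₂` and codiagonal image `codiag^* u = t₁ t₂`; read this off on the
local homomorphism `𝒪_{A,e} → K[ε₁, ε₂]` of `u`. [cite: GortzWedhorn2023, Rem. 27.18 (3)] -/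
theorem snd_evAt_mul (t₁ t₂ : specOver K (DualNumber K) ⟶ A.X) (h₁ : t₁ ∈ kerAug (A := A) (dualNumberAug K))
    (h₂ : t₂ ∈ kerAug (A := A) (dualNumberAug K)) (a : stalkOrigin A) :
    (evAt (t₁ * t₂).left (base_eq_origin_of_mem_kerAug (dualNumberAug K) (mul_mem h₁ h₂)) a).snd =
      (evAt t₁.left (base_eq_origin_of_mem_kerAug (dualNumberAug K) h₁) a).snd +
        (evAt t₂.left (base_eq_origin_of_mem_kerAug (dualNumberAug K) h₂) a).snd := by
  set u : specOver K (DualNumber₂ K) ⟶ A.X :=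
    (specOverMapOfAlgHom (DualNumber₂.incl₁ K) ≫ t₁) * (specOverMapOfAlgHom (DualNumber₂.incl₂ K) ≫ t₂) with hu_def
  have hu₁ : specOverMapOfAlgHom (DualNumber₂.proj₁ K) ≫ u = t₁ := by
    rw [hu_def, MonObj.comp_mul, ← Category.assoc, ← Category.assoc, specOverMapOfAlgHom_comp,
      specOverMapOfAlgHom_comp, DualNumber₂.proj₁_comp_incl₁, DualNumber₂.proj₁_comp_incl₂, specOverMapOfAlgHom_id,
      Category.id_comp, specOverMapOfAlgHom_ofId_comp_aug_comp (dualNumberAug K) h₂, mul_one]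
  have hu₂ : specOverMapOfAlgHom (DualNumber₂.proj₂ K) ≫ u = t₂ := by
    rw [hu_def, MonObj.comp_mul, ← Category.assoc, ← Category.assoc, specOverMapOfAlgHom_comp,
      specOverMapOfAlgHom_comp, DualNumber₂.proj₂_comp_incl₁, DualNumber₂.proj₂_comp_incl₂, specOverMapOfAlgHom_id,
      Category.id_comp, specOverMapOfAlgHom_ofId_comp_aug_comp (dualNumberAug K) h₁, one_mul]
  have huσ : specOverMapOfAlgHom (DualNumber₂.codiag K) ≫ u = t₁ * t₂ := by
    rw [hu_def, MonObj.comp_mul, ← Category.assoc, ← Category.assoc, specOverMapOfAlgHom_comp,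
      specOverMapOfAlgHom_comp, DualNumber₂.codiag_comp_incl₁, DualNumber₂.codiag_comp_incl₂, specOverMapOfAlgHom_id,
      Category.id_comp, Category.id_comp]
  have hu : u ∈ kerAug (A := A) (DualNumber₂.aug K) := by
    rw [mem_kerAug_iff, hu_def, MonObj.comp_mul, ← Category.assoc, ← Category.assoc,
      specOverMapOfAlgHom_comp, specOverMapOfAlgHom_comp, DualNumber₂.aug_comp_incl₁, DualNumber₂.aug_comp_incl₂,
      (mem_kerAug_iff _ t₁).mp h₁, (mem_kerAug_iff _ t₂).mp h₂, mul_one]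
  have hu0 := base_eq_origin_of_mem_kerAug (DualNumber₂.aug K) hu
  -- the local homomorphism of `u` and its three images
  have key : ∀ (ψ : (DualNumber₂ K) →ₐ[K] (DualNumber K)) [IsLocalHom ψ.toRingHom] (t : specOver K (DualNumber K) ⟶ A.X)
      (ht : t.left.base (IsLocalRing.closedPoint (DualNumber K)) = origin A),
      specOverMapOfAlgHom ψ ≫ u = t →
        evAt t.left ht = evAt u.left hu0 ≫ CommRingCat.ofHom ψ.toRingHom := by
    intro ψ _ t ht hψ
    have hψ' : Spec.map (CommRingCat.ofHom ψ.toRingHom) ≫ u.left = t.left :=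
      congrArg CommaMorphism.left hψ
    rw [← evAt_SpecMap_comp (CommRingCat.ofHom ψ.toRingHom) u.left hu0 (hψ'.symm ▸ ht)]
    exact evAt_congr hψ'.symm _ _
  have e₁ := key (DualNumber₂.proj₁ K) t₁ (base_eq_origin_of_mem_kerAug (dualNumberAug K) h₁) hu₁
  have e₂ := key (DualNumber₂.proj₂ K) t₂ (base_eq_origin_of_mem_kerAug (dualNumberAug K) h₂) hu₂
  have eσ := key (DualNumber₂.codiag K) (t₁ * t₂) (base_eq_origin_of_mem_kerAug (dualNumberAug K) (mul_mem h₁ h₂)) huσ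
  rw [e₁, e₂, eσ]
  change ((DualNumber₂.codiag K) (evAt u.left hu0 a)).snd =
    ((DualNumber₂.proj₁ K) (evAt u.left hu0 a)).snd + ((DualNumber₂.proj₂ K) (evAt u.left hu0 a)).snd
  simp only [snd_map, LinearMap.add_apply, LinearMap.fst_apply, LinearMap.snd_apply]

/-- The `ε`-part of the local homomorphism, as a homomorphism from the group `Lie(A)` of
`K[ε]`-points at the origin to the additive group of functions `𝒪_{A,e} → K`
(Görtz–Wedhorn II, (27.4.6)). [folklore] -/
def sndEvAtHom : kerAug (A := A) (dualNumberAug K) →* Multiplicative (stalkOrigin A → K) :=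
  MonoidHom.mk'
    (fun t => Multiplicative.ofAdd fun a =>
      (evAt t.1.left (base_eq_origin_of_mem_kerAug (dualNumberAug K) t.2) a).snd)
    (fun t₁ t₂ => by
      rw [← ofAdd_add]
      congr 1
      funext a
      exact snd_evAt_mul t₁.1 t₂.1 t₁.2 t₂.2 a)

/-- Unfolding of `sndEvAtHom`. [folklore] -/
theorem sndEvAtHom_apply (t : kerAug (A := A) (dualNumberAug K)) (a : stalkOrigin A) :
    (sndEvAtHom t).toAdd a = (evAt t.1.left (base_eq_origin_of_mem_kerAug (dualNumberAug K) t.2) a).snd :=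
  rfl

/-- **`T_e([n]) = n` on `K[ε]`-points:** the `ε`-part of the local homomorphism of `tⁿ` is `n`
times that of `t` (Görtz–Wedhorn II, proof of Prop. 27.187: `Lie([n]) = n`).
[cite: GortzWedhorn2023, proof of Prop. 27.187 (p. 888)] -/
theorem snd_evAt_zpow (t : kerAug (A := A) (dualNumberAug K)) (n : ℤ) (a : stalkOrigin A) :
    (evAt (t ^ n).1.left (base_eq_origin_of_mem_kerAug (dualNumberAug K) (t ^ n).2) a).snd =
      n • (evAt t.1.left (base_eq_origin_of_mem_kerAug (dualNumberAug K) t.2) a).snd := by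
  rw [← sndEvAtHom_apply, ← sndEvAtHom_apply, map_zpow, toAdd_zpow, Pi.smul_apply]

/-- `tⁿ = t ≫ [n]_A` for points of `A` (Mathlib `GrpObj.comp_zpow`). [folklore] -/
theorem zpow_eq_comp_zsmul_id {T : SchemeOver K} (t : T ⟶ A.X) (n : ℤ) :
    t ^ n = t ≫ (n • 𝟙 A).hom.hom.hom := by
  rw [hom_zsmul_id, GrpObj.comp_zpow, Category.comp_id]

end LieAddition

/-! ### Tangent vectors: local `K`-algebra maps `𝒪_{A,e} → K[ε]` separate `𝔪_e/𝔪_e²` -/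

section TangentVectors

open TrivSqZeroExt AlgPoints

variable (A)

/-- The local `K`-algebra homomorphism `𝒪_{A,e} → K` "evaluation at the origin" (the local
homomorphism of the trivial `K`-point). [folklore] -/
def evalOrigin : stalkOrigin A →+* K :=
  (evAt (R := CommRingCat.of K) (1 : specOver K K ⟶ A.X).left (one_left_base _)).hom

/-- Evaluation at the origin is local. [folklore] -/
instance : IsLocalHom (evalOrigin A) :=
  isLocalHom_evAt (R := CommRingCat.of K) (1 : specOver K K ⟶ A.X).left (one_left_base _)

/-- Evaluation at the origin is a `K`-algebra map. [folklore] -/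
theorem evalOrigin_comp_algebraMap :
    (evalOrigin A).comp (stalkOriginAlgebraMap A) = RingHom.id K := by
  rw [evalOrigin, evAt_comp_algebraMap, Algebra.algebraMap_self]

/-- Evaluation of a constant. [folklore] -/
theorem evalOrigin_algebraMap (c : K) : evalOrigin A (stalkOriginAlgebraMap A c) = c := by
  rw [← RingHom.comp_apply, evalOrigin_comp_algebraMap, RingHom.id_apply]

/-- `a ≡ ev_e(a) mod 𝔪_e`: `𝒪_{A,e} = K ⊕ 𝔪_e`. [folklore] -/
theorem sub_algebraMap_evalOrigin_mem (a : stalkOrigin A) :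
    a - stalkOriginAlgebraMap A (evalOrigin A a) ∈ IsLocalRing.maximalIdeal (stalkOrigin A) := by
  obtain ⟨c, hc⟩ := exists_sub_algebraMap_mem_maximalIdeal A a
  have h0 : evalOrigin A (a - stalkOriginAlgebraMap A c) = 0 := by
    by_contra hne
    exact (IsLocalRing.mem_maximalIdeal _).mp hc
      ((isUnit_map_iff (evalOrigin A) _).mp (isUnit_iff_ne_zero.mpr hne))
  rw [map_sub, evalOrigin_algebraMap, sub_eq_zero] at h0
  rwa [h0]

/-- Evaluation at the origin kills `𝔪_e`. [folklore] -/
theorem evalOrigin_eq_zero_of_mem {a : stalkOrigin A}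
    (ha : a ∈ IsLocalRing.maximalIdeal (stalkOrigin A)) : evalOrigin A a = 0 := by
  by_contra hne
  exact (IsLocalRing.mem_maximalIdeal _).mp ha
    ((isUnit_map_iff (evalOrigin A) _).mp (isUnit_iff_ne_zero.mpr hne))

variable {A}

variable (ℓ : stalkOrigin A →+ K)
  (hℓs : ∀ (c : K) (a : stalkOrigin A), ℓ (stalkOriginAlgebraMap A c * a) = c * ℓ a)
  (hℓK : ∀ c : K, ℓ (stalkOriginAlgebraMap A c) = 0)
  (hℓ2 : ∀ x ∈ IsLocalRing.maximalIdeal (stalkOrigin A) ^ 2, ℓ x = 0)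

include hℓs hℓK hℓ2 in
/-- The Leibniz rule for a linear form on `𝔪_e/𝔪_e²` extended by zero on constants:
`ℓ(ab) = ev_e(a) ℓ(b) + ev_e(b) ℓ(a)` (linear forms on `𝔪_e/𝔪_e²` are point derivations). [folklore] -/
theorem linearForm_leibniz (a b : stalkOrigin A) :
    ℓ (a * b) = evalOrigin A a * ℓ b + evalOrigin A b * ℓ a := by
  set a' := a - stalkOriginAlgebraMap A (evalOrigin A a) with ha'
  set b' := b - stalkOriginAlgebraMap A (evalOrigin A b) with hb'
  have hab : a * b = stalkOriginAlgebraMap A (evalOrigin A a * evalOrigin A b) +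
      stalkOriginAlgebraMap A (evalOrigin A a) * b' +
      stalkOriginAlgebraMap A (evalOrigin A b) * a' + a' * b' := by
    rw [map_mul, ha', hb']; ring
  have h2 : ℓ (a' * b') = 0 := hℓ2 _ (by
    rw [pow_two]
    exact Ideal.mul_mem_mul (sub_algebraMap_evalOrigin_mem A a)
      (sub_algebraMap_evalOrigin_mem A b))
  have hb'' : ℓ b' = ℓ b := by rw [hb', map_sub, hℓK, sub_zero]
  have ha'' : ℓ a' = ℓ a := by rw [ha', map_sub, hℓK, sub_zero]
  rw [hab, map_add, map_add, map_add, hℓK, hℓs, hℓs, h2, hb'', ha'']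
  ring

/-- The tangent vector `a ↦ ev_e(a) + ℓ(a) ε : 𝒪_{A,e} → K[ε]` attached to an additive map
`ℓ : 𝒪_{A,e} → K` which is `K`-linear (`ℓ(c a) = c ℓ(a)` for constants `c`), kills the constants
and kills `𝔪_e²` (i.e. a linear form on `𝔪_e/𝔪_e²`; Görtz–Wedhorn II, (27.4.6): tangent vectors
as `K[ε]`-points; Mathlib has the ring-level `derivationToSquareZeroEquivLift` but no scheme-level
tangent vectors). [folklore] -/
def tangentHom : stalkOrigin A →+* (DualNumber K) where
  toFun a := inl (evalOrigin A a) + inr (ℓ a)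
  map_one' := by
    have h1 : ℓ 1 = 0 := by rw [← map_one (stalkOriginAlgebraMap A)]; exact hℓK 1
    rw [map_one, h1, inr_zero, add_zero]
    rfl
  map_mul' a b := by
    apply TrivSqZeroExt.ext
    · simp only [fst_add, fst_inl, fst_inr, add_zero, fst_mul, map_mul (evalOrigin A)]
    · simp only [snd_add, snd_inl, snd_inr, zero_add, snd_mul, fst_add, fst_inl, fst_inr, add_zero,
        smul_eq_mul, MulOpposite.smul_eq_mul_unop, MulOpposite.unop_op, linearForm_leibniz ℓ hℓs hℓK hℓ2]
      ring
  map_zero' := by rw [map_zero, map_zero, inl_zero, inr_zero, add_zero]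
  map_add' a b := by
    rw [map_add, map_add, inl_add, inr_add]
    abel

/-- Unfolding of `tangentHom`. [folklore] -/
theorem tangentHom_apply (a : stalkOrigin A) :
    tangentHom ℓ hℓs hℓK hℓ2 a = inl (evalOrigin A a) + inr (ℓ a) := rfl

/-- The `ε`-part of `tangentHom ℓ` is `ℓ`. [folklore] -/
theorem snd_tangentHom_apply (a : stalkOrigin A) : (tangentHom ℓ hℓs hℓK hℓ2 a).snd = ℓ a := by
  rw [tangentHom_apply, snd_add, snd_inl, snd_inr, zero_add]

/-- The constant part of `tangentHom ℓ` is evaluation at the origin. [folklore] -/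
theorem fst_tangentHom_apply (a : stalkOrigin A) :
    (tangentHom ℓ hℓs hℓK hℓ2 a).fst = evalOrigin A a := by
  rw [tangentHom_apply, fst_add, fst_inl, fst_inr, add_zero]

/-- `tangentHom ℓ` is local. [folklore] -/
instance isLocalHom_tangentHom : IsLocalHom (tangentHom ℓ hℓs hℓK hℓ2) :=
  ⟨fun a ha => by
    rw [isUnit_iff_isUnit_fst, fst_tangentHom_apply] at ha
    exact (isUnit_map_iff (evalOrigin A) a).mp ha⟩

/-- `tangentHom ℓ` is local (bundled form). [folklore] -/
instance isLocalHom_ofHom_tangentHom :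
    IsLocalHom (CommRingCat.ofHom (tangentHom ℓ hℓs hℓK hℓ2)).hom :=
  isLocalHom_tangentHom ℓ hℓs hℓK hℓ2

/-- `tangentHom ℓ` is a `K`-algebra map. [folklore] -/
theorem tangentHom_comp_algebraMap :
    (tangentHom ℓ hℓs hℓK hℓ2).comp (stalkOriginAlgebraMap A) = algebraMap K (DualNumber K) := by
  ext c
  · rw [RingHom.comp_apply, fst_tangentHom_apply, evalOrigin_algebraMap, algebraMap_eq_inl',
      fst_inl, Algebra.algebraMap_self, RingHom.id_apply]
  · rw [RingHom.comp_apply, snd_tangentHom_apply, hℓK, algebraMap_eq_inl', snd_inl]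

/-- The `K[ε]`-point of `A` at the origin defined by a tangent vector
(Görtz–Wedhorn II, (27.4.6)). [folklore] -/
def tangentPt : kerAug (A := A) (dualNumberAug K) :=
  ⟨ptOver (CommRingCat.ofHom (tangentHom ℓ hℓs hℓK hℓ2)) (tangentHom_comp_algebraMap ℓ hℓs hℓK hℓ2),
    mem_kerAug_of_base_eq_origin (dualNumberAug K) (by
      rw [ptOver_left]
      exact ptOfStalkHom_closedPoint (R := CommRingCat.of (DualNumber K)) _)⟩

/-- The local homomorphism of `tangentPt ℓ` is `tangentHom ℓ`. [folklore] -/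
theorem evAt_tangentPt
    (h : (tangentPt ℓ hℓs hℓK hℓ2).1.left.base (IsLocalRing.closedPoint (DualNumber K)) = origin A) :
    evAt (tangentPt ℓ hℓs hℓK hℓ2).1.left h = CommRingCat.ofHom (tangentHom ℓ hℓs hℓK hℓ2) :=
  evAt_ptOfStalkHom (R := CommRingCat.of (DualNumber K)) _ _

/-- **Tangent vectors separate the cotangent space:** an element of `𝔪_e` killed by all linear
forms `ℓ` as in `tangentHom` lies in `𝔪_e²` (linear forms on the `K`-vector space
`𝒪_{A,e}/(K + 𝔪_e²)` separate points, Mathlib `Submodule.exists_dual_map_eq_bot_of_notMem`). [folklore] -/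
theorem mem_sq_of_forall_eq_zero {x : stalkOrigin A} (hx : x ∈ IsLocalRing.maximalIdeal (stalkOrigin A))
    (h : ∀ (ℓ : stalkOrigin A →+ K),
      (∀ (c : K) (a : stalkOrigin A), ℓ (stalkOriginAlgebraMap A c * a) = c * ℓ a) →
      (∀ c : K, ℓ (stalkOriginAlgebraMap A c) = 0) →
      (∀ y ∈ IsLocalRing.maximalIdeal (stalkOrigin A) ^ 2, ℓ y = 0) → ℓ x = 0) :
    x ∈ IsLocalRing.maximalIdeal (stalkOrigin A) ^ 2 := by
  letI : Algebra K (stalkOrigin A) := (stalkOriginAlgebraMap A).toAlgebra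
  let W : Submodule K (stalkOrigin A) :=
    LinearMap.range (Algebra.linearMap K (stalkOrigin A)) ⊔
      (IsLocalRing.maximalIdeal (stalkOrigin A) ^ 2).restrictScalars K
  by_contra hx2
  have hxW : x ∉ W := by
    intro hxW
    obtain ⟨y, hy, z, hz, rfl⟩ := Submodule.mem_sup.mp hxW
    obtain ⟨c, rfl⟩ := LinearMap.mem_range.mp hy
    have hz' : z ∈ IsLocalRing.maximalIdeal (stalkOrigin A) ^ 2 := hz
    have hc : algebraMap K (stalkOrigin A) c ∈ IsLocalRing.maximalIdeal (stalkOrigin A) := by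
      have := Ideal.sub_mem _ hx (Ideal.pow_le_self two_ne_zero hz')
      rwa [add_sub_cancel_right, Algebra.linearMap_apply] at this
    have hc0 : c = 0 := by
      by_contra hc0
      exact (IsLocalRing.mem_maximalIdeal _).mp hc
        ((isUnit_iff_ne_zero.mpr hc0).map (algebraMap K (stalkOrigin A)))
    apply hx2
    rw [hc0, map_zero, zero_add]
    exact hz'
  obtain ⟨f, hfx, hfW⟩ := Submodule.exists_dual_map_eq_bot_of_notMem hxW inferInstance
  have hfW' : ∀ w ∈ W, f w = 0 := fun w hw => by
    have : f w ∈ W.map f := Submodule.mem_map_of_mem hw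
    rwa [hfW, Submodule.mem_bot] at this
  apply hfx
  refine h f.toAddMonoidHom (fun c a => ?_) (fun c => ?_) (fun y hy => ?_)
  · change f (stalkOriginAlgebraMap A c * a) = c * f a
    rw [← smul_eq_mul c (f a), ← f.map_smul, Algebra.smul_def]
    rfl
  · exact hfW' _ (Submodule.mem_sup_left (LinearMap.mem_range.mpr ⟨c, rfl⟩))
  · exact hfW' _ (Submodule.mem_sup_right hy)

/-- **`Lie([n]_A) = n`** (Görtz–Wedhorn II, proof of Prop. 27.187 with Rem. 27.18 (3)): the named
fact `cotangentMap_zsmul_id A` holds. For `a ∈ 𝔪_e` and a tangent vector `t : Spec K[ε] → A` with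
linear form `ℓ`, the `K[ε]`-point `tⁿ = t ≫ [n]` has linear form `n ℓ` (`T_e(m)` is addition) and
also `ℓ ∘ [n]^*`; hence `ℓ([n]^* a - n a) = 0` for all `ℓ`, and tangent vectors separate
`𝔪_e/𝔪_e²`. [cite: GortzWedhorn2023, proof of Prop. 27.187 (p. 888) and Rem. 27.18 (3)] -/
theorem cotangentMap_zsmul_id_holds : cotangentMap_zsmul_id A := by
  intro n a ha
  apply mem_sq_of_forall_eq_zero
  · exact Ideal.sub_mem _ (stalkMapZsmulId_mem n ha)
      (by rw [zsmul_eq_mul]; exact Ideal.mul_mem_left _ _ ha)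
  intro ℓ hℓs hℓK hℓ2
  set t := tangentPt ℓ hℓs hℓK hℓ2 with ht_def
  have h0 := base_eq_origin_of_mem_kerAug (dualNumberAug K) t.2
  have hn := base_eq_origin_of_mem_kerAug (dualNumberAug K) (t ^ n).2
  -- the linear form of `tⁿ` is `n ℓ`
  have e1 := snd_evAt_zpow t n a
  -- and it is `ℓ ∘ [n]^*`
  have hcomp : (t ^ n).1.left = t.1.left ≫ Hom.toSchemeHom (n • 𝟙 A) := by
    rw [Subgroup.coe_zpow, zpow_eq_comp_zsmul_id]
    rfl
  have e2 : evAt (t ^ n).1.left hn = stalkMapZsmulId A n ≫ evAt t.1.left h0 := by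
    rw [evAt_congr hcomp hn (hcomp ▸ hn)]
    exact evAt_comp_zsmul_id (R := CommRingCat.of (DualNumber K)) _ h0 n _
  have e3 : (evAt (t ^ n).1.left hn a).snd = ℓ (stalkMapZsmulId A n a) := by
    rw [e2, CommRingCat.comp_apply, evAt_tangentPt]
    exact snd_tangentHom_apply ℓ hℓs hℓK hℓ2 _
  have e4 : (evAt t.1.left h0 a).snd = ℓ a := by
    rw [evAt_tangentPt]
    exact snd_tangentHom_apply ℓ hℓs hℓK hℓ2 _
  rw [e3, e4] at e1
  rw [map_sub, map_zsmul, e1, sub_self]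

end TangentVectors

/-! ### Conclusions -/

/-- **`[n]_A` is étale for `n` invertible in `K`** (Görtz–Wedhorn II, Prop. 27.187; Mumford,
*Abelian Varieties*, §6, Application 3, Proposition p. 64 (2)): the named fact `etale_zsmul_id A` of
`AbelianVarietyTorsion` holds (`etale_zsmul_id_of_cotangentMap` and `cotangentMap_zsmul_id_holds`).
[cite: GortzWedhorn2023, Prop. 27.187] -/
theorem etale_zsmul_id_holds : etale_zsmul_id A :=
  etale_zsmul_id_of_cotangentMap (cotangentMap_zsmul_id_holds (A := A))

/-- **`[n]_A` is an isogeny for `n` invertible in `K`** (Görtz–Wedhorn II, Prop. 27.187: finite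
étale, and surjective, Prop. 27.186). [cite: GortzWedhorn2023, Prop. 27.187] -/
theorem isIsogeny_zsmul_id_of_cast_ne_zero (n : ℤ) (hn : (n : K) ≠ 0) : IsIsogeny (n • 𝟙 A) :=
  isIsogeny_zsmul_id_of_cotangentMap (cotangentMap_zsmul_id_holds (A := A)) n hn

/-- In characteristic zero, `[n]_A` is an isogeny for every `n ≠ 0`: the named fact
`isIsogeny_zsmul_id A` of `AbelianVarietyTorsion` (Görtz–Wedhorn II, Prop. 27.186, first assertion)
holds when `char K = 0`. [cite: GortzWedhorn2023, Prop. 27.186 and Prop. 27.187] -/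
theorem isIsogeny_zsmul_id_holds_of_charZero [CharZero K] : isIsogeny_zsmul_id A :=
  fun n hn => isIsogeny_zsmul_id_of_cast_ne_zero n (Int.cast_ne_zero.mpr hn)

/-- **Torsion points from `deg [n] = n^{2g}` alone.** The named fact
`natCard_torsionPoints_of_isAlgClosed A L` (`#A[n](L) = n^{2g}` over `L ⊇ K` algebraically closed, `n`
invertible in `K`; Görtz–Wedhorn II, Prop. 27.188 (1); Mumford, *Abelian Varieties*, §6, Application 3,
Proposition p. 64) now follows from the single named fact `kerRank_zsmul_id A` (`deg [n]_A = n^{2g}`,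
Prop. 27.186, theorem of the cube). [cite: GortzWedhorn2023, Prop. 27.188 (1)] -/
theorem natCard_torsionPoints_of_isAlgClosed_of_kerRank (L : Type u) [Field L] [Algebra K L]
    (h₂ : kerRank_zsmul_id A) : natCard_torsionPoints_of_isAlgClosed A L :=
  natCard_torsionPoints_of_isAlgClosed_of A L h₂ etale_zsmul_id_holds

end AbelianVariety

end Literature.AlgebraicGeometry.Motives

end
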